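import Summits.Parity.BatemanHorn.Theorems.RoughParitySectorsOddSectorShareNonlinearSqueezes
import Summits.Parity.BatemanHorn.Theorems.RoughParitySectorsRoughCountBand

/-!
# Route `RoughParitySectors`: EXACTNESS of the split `BH = P ∧ A` ("two out of three") and the
# `Assembly` item (stmt-Parity-15632) — by the lead of crux `OddSectorShareNonlinear` (stmt-Parity-15628)

Everything here is PROVED (no `sorry`, no new definition, no new fact).  It closes the route's
bookkeeping item `Assembly` BY NAME (`assembly_proof`, one line over the route's deciding theorem
`Theses.RoughParitySectors.closes`) and pins the exact strength of the share crux
`OddSectorShareNonlinear` inside the route.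

The route cuts Bateman–Horn along a system `f` into three statements in the iterated limit
"`x → ∞`, then `U → ∞`" over the jointly rough set `R_f(x,U)` (thresholds `x^{deg fᵢ/U}`):
the parity balance `P_f : 2^k·c_odd = #R·(1 ± δ)` (crux `RoughParityBalance`), the odd-sector share
`A_f : c₁·(U e^{−γ}/2)^k = c_odd·(1 ± η)` (cruxes `OddSectorShareNonlinear` / `OddSectorShareLinear`,
split by degree profile) and the COUNT `#R·(log x)^k/x = (C(f)/∏deg fᵢ)·e^{−kγ}·U^k·(1 ± ε)`, which is
a THEOREM (`Theorems.RoughCountBand.roughCountBand_proof`, the support item `RoughCountBand`).  The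
deciding theorem `closes` is the direction `P ∧ A ⟹ BH`.  This file proves the two other directions,
system by system:

* `Exactness.share_of_asymptotic_of_balance` — `BatemanHornAsymptotic f ∧ P_f ⟹ A_f`;
* `Exactness.balance_of_asymptotic_of_share` — `BatemanHornAsymptotic f ∧ A_f ⟹ P_f`;

from the two calibrations of `RoughParitySectorsRoughCountBand.lean` (`primeCell_calibration`: under
`BatemanHornAsymptotic f`, `|c₁·(log x)^k − m·x| ≤ τ·x` eventually, `m = C(f)/∏deg fᵢ`, for every
`U ≥ 4·max deg fᵢ + 1`; `roughCard_calibration`: `|#R·(log x)^k − x·m·e^{−kγ}U^k| ≤ τ·x·m·e^{−kγ}U^k`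
for `U ≥ U₀(τ)`, eventually) and the two real-arithmetic squeezes of
`RoughParitySectorsOddSectorShareNonlinearSqueezes.lean`.  Route-level corollaries:

* `oddSectorShareNonlinear_of_batemanHorn_of_roughParityBalance : BatemanHorn → RoughParityBalance →
  OddSectorShareNonlinear` (and the `Linear` twin), `roughParityBalance_of_batemanHorn_of_shares :
  BatemanHorn → OddSectorShareNonlinear → OddSectorShareLinear → RoughParityBalance`;
* `oddSectorShares_iff_batemanHorn : RoughParityBalance → (OddSectorShareNonlinear ∧
  OddSectorShareLinear ↔ BatemanHorn)` and `roughParityBalance_iff_batemanHorn :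
  OddSectorShareNonlinear → OddSectorShareLinear → (RoughParityBalance ↔ BatemanHorn)`;
* `oddSectorShares_of_complement` / `roughParityBalance_of_complement` — minimality: any `X` with
  `P → X → BH` gives `P → X → (A ∧ L)`, any `X` with `X → A → L → BH` gives `X → A → L → P`;
* `assembly_proof : Theses.RoughParitySectors.Assembly`.

So any two of {Bateman–Horn along `f`, parity balance of the rough values of `f`, odd-sector share
along `f`} give the third: MODULO THE PARITY CRUX the share crux IS Bateman–Horn (for systems with a
member of degree `≥ 2`), and modulo the share cruxes the parity crux is Bateman–Horn — the kernel form
of the route header's "exact parity-immune complement".  In particular the share crux carries no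
difficulty beyond `BH ∧ P` and no less than `BH` once `P` is known; nothing here advances it.

References: Bateman–Horn, Math. Comp. 16 (1962) (1)–(2) [BatemanHorn1962]; K. Alladi, Quart. J. Math.
33 (1982) [Alladi1982]; Halberstam–Richert, *Sieve Methods* (1974), Thm 2.5 [HalberstamRichert1974].
-/

namespace Summit.Parity.BatemanHorn.Cruxes.OddSectorShareNonlinear.Birth

open Filter Finset Polynomial
open scoped Topology
open Literature.NumberTheory.Sieve
open Summit.Parity.BatemanHorn.Theorems.RoughCountBand

namespace Exactness

/-! ### §5 Two out of three, system by system -/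

/-- **`BH_f ∧ P_f ⟹ A_f`.**  For a Bateman–Horn system `f` satisfying the Bateman–Horn asymptotic
and the parity balance of its jointly rough values (`|2^k·c_odd − #R| ≤ δ·#R` for `U ≥ U₀(δ)`,
eventually), the odd-sector share statement holds: `|c₁·(U e^{−γ}/2)^k − c_odd| ≤ η·c_odd` for
`U ≥ U₀(η)`, eventually in `x` (the conclusion of `OddSectorShareNonlinear` / `OddSectorShareLinear`
for `f`).  Squeeze through the prime-cell and rough-count calibrations with
`τ = min(1/4, ηm/(2(1+3m)))`. [folklore] -/
theorem share_of_asymptotic_of_balance {k : ℕ} {f : Fin k → ℤ[X]} (hf : IsBatemanHornSystem f)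
    (hBH : BatemanHornAsymptotic f)
    (hP : ∀ δ : ℝ, 0 < δ → ∃ U₀ : ℝ, ∀ U : ℝ, U₀ ≤ U → ∀ᶠ x : ℕ in Filter.atTop,
      |(2 : ℝ) ^ k * (((((Finset.Icc 1 x).filter (fun n : ℕ => ∀ i, 0 < (f i).eval (n : ℤ) ∧
          ∀ p ∈ Finset.range ⌈(x : ℝ) ^ (((f i).natDegree : ℝ) / U)⌉₊, p.Prime →
            ¬ ((p : ℤ) ∣ (f i).eval (n : ℤ)))).filter (fun n : ℕ => ∀ i,
          Odd (ArithmeticFunction.cardFactors (((f i).eval (n : ℤ)).toNat)))).card : ℕ) : ℝ) -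
        ((((Finset.Icc 1 x).filter (fun n : ℕ => ∀ i, 0 < (f i).eval (n : ℤ) ∧
          ∀ p ∈ Finset.range ⌈(x : ℝ) ^ (((f i).natDegree : ℝ) / U)⌉₊, p.Prime →
            ¬ ((p : ℤ) ∣ (f i).eval (n : ℤ)))).card : ℕ) : ℝ)| ≤
        δ * ((((Finset.Icc 1 x).filter (fun n : ℕ => ∀ i, 0 < (f i).eval (n : ℤ) ∧
          ∀ p ∈ Finset.range ⌈(x : ℝ) ^ (((f i).natDegree : ℝ) / U)⌉₊, p.Prime →
            ¬ ((p : ℤ) ∣ (f i).eval (n : ℤ)))).card : ℕ) : ℝ)) :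
    ∀ η : ℝ, 0 < η → ∃ U₀ : ℝ, ∀ U : ℝ, U₀ ≤ U → ∀ᶠ x : ℕ in Filter.atTop,
      |(((((Finset.Icc 1 x).filter (fun n : ℕ => ∀ i, 0 < (f i).eval (n : ℤ) ∧
          ∀ p ∈ Finset.range ⌈(x : ℝ) ^ (((f i).natDegree : ℝ) / U)⌉₊, p.Prime →
            ¬ ((p : ℤ) ∣ (f i).eval (n : ℤ)))).filter (fun n : ℕ => ∀ i,
          ArithmeticFunction.cardFactors (((f i).eval (n : ℤ)).toNat) = 1)).card : ℕ) : ℝ) *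
          (U * Real.exp (-Real.eulerMascheroniConstant) / 2) ^ k -
        (((((Finset.Icc 1 x).filter (fun n : ℕ => ∀ i, 0 < (f i).eval (n : ℤ) ∧
          ∀ p ∈ Finset.range ⌈(x : ℝ) ^ (((f i).natDegree : ℝ) / U)⌉₊, p.Prime →
            ¬ ((p : ℤ) ∣ (f i).eval (n : ℤ)))).filter (fun n : ℕ => ∀ i,
          Odd (ArithmeticFunction.cardFactors (((f i).eval (n : ℤ)).toNat)))).card : ℕ) : ℝ)| ≤
        η * (((((Finset.Icc 1 x).filter (fun n : ℕ => ∀ i, 0 < (f i).eval (n : ℤ) ∧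
          ∀ p ∈ Finset.range ⌈(x : ℝ) ^ (((f i).natDegree : ℝ) / U)⌉₊, p.Prime →
            ¬ ((p : ℤ) ∣ (f i).eval (n : ℤ)))).filter (fun n : ℕ => ∀ i,
          Odd (ArithmeticFunction.cardFactors (((f i).eval (n : ℤ)).toNat)))).card : ℕ) : ℝ) := by
  intro η hη
  obtain ⟨_, hC0⟩ := IsBatemanHornSystem.hasBatemanHornConst_holds hf
  set m : ℝ := batemanHornConst f / ∏ i, ((f i).natDegree : ℝ) with hm
  have hm0 : 0 < m := div_pos hC0 (prod_pos fun i _ => by exact_mod_cast hf.natDegree_pos i)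
  -- the common tolerance
  set τ : ℝ := min (1 / 4) (η * m / (2 * (1 + 3 * m))) with hτ
  have hτ0 : 0 < τ := lt_min (by norm_num) (by positivity)
  have hτ4 : τ ≤ 1 / 4 := min_le_left _ _
  have hτη : 2 * τ * (1 + 3 * m) / m ≤ η := by
    have h1 : τ ≤ η * m / (2 * (1 + 3 * m)) := min_le_right _ _
    rw [le_div_iff₀ (by positivity)] at h1
    rw [div_le_iff₀ hm0]
    linarith
  obtain ⟨U_R, hR⟩ := roughCard_calibration hf τ hτ0
  obtain ⟨U_P, hPU⟩ := hP τ hτ0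
  refine ⟨max (max U_R U_P) (4 * ((univ.sup fun i => (f i).natDegree : ℕ) : ℝ) + 1),
    fun U hU => ?_⟩
  have hUR : U_R ≤ U := le_trans (le_trans (le_max_left _ _) (le_max_left _ _)) hU
  have hUP : U_P ≤ U := le_trans (le_trans (le_max_right _ _) (le_max_left _ _)) hU
  have hUc : 4 * ((univ.sup fun i => (f i).natDegree : ℕ) : ℝ) + 1 ≤ U :=
    le_trans (le_max_right _ _) hU
  have hU0 : 0 < U := by
    linarith [Nat.cast_nonneg (α := ℝ) (univ.sup fun i => (f i).natDegree)]
  filter_upwards [primeCell_calibration hf hBH τ hτ0 U hUc, hR U hUR, hPU U hUP,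
    eventually_ge_atTop 2] with x h1 h2 h3 hx2
  have hX : (0 : ℝ) < x := by exact_mod_cast (by omega : 0 < x)
  have hL0 : 0 < Real.log x ^ k := pow_pos (Real.log_pos (by exact_mod_cast hx2)) k
  have hAk : 0 < (U * Real.exp (-Real.eulerMascheroniConstant) / 2) ^ k := by positivity
  have hQ : (0 : ℝ) < 2 ^ k := by positivity
  have hid : m * Real.exp (-((k : ℝ) * Real.eulerMascheroniConstant)) * U ^ k =
      m * ((2 : ℝ) ^ k * (U * Real.exp (-Real.eulerMascheroniConstant) / 2) ^ k) := by
    rw [two_pow_mul_shareBase_pow, mul_assoc]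
  rw [hid] at h2
  have key := share_arith hL0 hX hm0 hAk hQ hτ0.le hτ4 h1 h2 h3
  exact key.trans (mul_le_mul_of_nonneg_right hτη (Nat.cast_nonneg _))

/-- **`BH_f ∧ A_f ⟹ P_f`.**  For a Bateman–Horn system `f` satisfying the Bateman–Horn asymptotic
and the odd-sector share statement (`|c₁·(U e^{−γ}/2)^k − c_odd| ≤ η·c_odd` for `U ≥ U₀(η)`,
eventually), the parity balance holds: `|2^k·c_odd − #R| ≤ δ·#R` for `U ≥ U₀(δ)`, eventually in `x`
(the conclusion of `RoughParityBalance` for `f`).  Squeeze with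
`τ = min(1/4, m/4, δm/(2(3m+1)))`. [folklore] -/
theorem balance_of_asymptotic_of_share {k : ℕ} {f : Fin k → ℤ[X]} (hf : IsBatemanHornSystem f)
    (hBH : BatemanHornAsymptotic f)
    (hA : ∀ η : ℝ, 0 < η → ∃ U₀ : ℝ, ∀ U : ℝ, U₀ ≤ U → ∀ᶠ x : ℕ in Filter.atTop,
      |(((((Finset.Icc 1 x).filter (fun n : ℕ => ∀ i, 0 < (f i).eval (n : ℤ) ∧
          ∀ p ∈ Finset.range ⌈(x : ℝ) ^ (((f i).natDegree : ℝ) / U)⌉₊, p.Prime →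
            ¬ ((p : ℤ) ∣ (f i).eval (n : ℤ)))).filter (fun n : ℕ => ∀ i,
          ArithmeticFunction.cardFactors (((f i).eval (n : ℤ)).toNat) = 1)).card : ℕ) : ℝ) *
          (U * Real.exp (-Real.eulerMascheroniConstant) / 2) ^ k -
        (((((Finset.Icc 1 x).filter (fun n : ℕ => ∀ i, 0 < (f i).eval (n : ℤ) ∧
          ∀ p ∈ Finset.range ⌈(x : ℝ) ^ (((f i).natDegree : ℝ) / U)⌉₊, p.Prime →
            ¬ ((p : ℤ) ∣ (f i).eval (n : ℤ)))).filter (fun n : ℕ => ∀ i,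
          Odd (ArithmeticFunction.cardFactors (((f i).eval (n : ℤ)).toNat)))).card : ℕ) : ℝ)| ≤
        η * (((((Finset.Icc 1 x).filter (fun n : ℕ => ∀ i, 0 < (f i).eval (n : ℤ) ∧
          ∀ p ∈ Finset.range ⌈(x : ℝ) ^ (((f i).natDegree : ℝ) / U)⌉₊, p.Prime →
            ¬ ((p : ℤ) ∣ (f i).eval (n : ℤ)))).filter (fun n : ℕ => ∀ i,
          Odd (ArithmeticFunction.cardFactors (((f i).eval (n : ℤ)).toNat)))).card : ℕ) : ℝ)) :
    ∀ δ : ℝ, 0 < δ → ∃ U₀ : ℝ, ∀ U : ℝ, U₀ ≤ U → ∀ᶠ x : ℕ in Filter.atTop,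
      |(2 : ℝ) ^ k * (((((Finset.Icc 1 x).filter (fun n : ℕ => ∀ i, 0 < (f i).eval (n : ℤ) ∧
          ∀ p ∈ Finset.range ⌈(x : ℝ) ^ (((f i).natDegree : ℝ) / U)⌉₊, p.Prime →
            ¬ ((p : ℤ) ∣ (f i).eval (n : ℤ)))).filter (fun n : ℕ => ∀ i,
          Odd (ArithmeticFunction.cardFactors (((f i).eval (n : ℤ)).toNat)))).card : ℕ) : ℝ) -
        ((((Finset.Icc 1 x).filter (fun n : ℕ => ∀ i, 0 < (f i).eval (n : ℤ) ∧
          ∀ p ∈ Finset.range ⌈(x : ℝ) ^ (((f i).natDegree : ℝ) / U)⌉₊, p.Prime →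
            ¬ ((p : ℤ) ∣ (f i).eval (n : ℤ)))).card : ℕ) : ℝ)| ≤
        δ * ((((Finset.Icc 1 x).filter (fun n : ℕ => ∀ i, 0 < (f i).eval (n : ℤ) ∧
          ∀ p ∈ Finset.range ⌈(x : ℝ) ^ (((f i).natDegree : ℝ) / U)⌉₊, p.Prime →
            ¬ ((p : ℤ) ∣ (f i).eval (n : ℤ)))).card : ℕ) : ℝ) := by
  intro δ hδ
  obtain ⟨_, hC0⟩ := IsBatemanHornSystem.hasBatemanHornConst_holds hf
  set m : ℝ := batemanHornConst f / ∏ i, ((f i).natDegree : ℝ) with hm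
  have hm0 : 0 < m := div_pos hC0 (prod_pos fun i _ => by exact_mod_cast hf.natDegree_pos i)
  -- the common tolerance
  set τ : ℝ := min (min (1 / 4) (m / 4)) (δ * m / (2 * (3 * m + 1))) with hτ
  have hτ0 : 0 < τ := lt_min (lt_min (by norm_num) (by positivity)) (by positivity)
  have hτ4 : τ ≤ 1 / 4 := le_trans (min_le_left _ _) (min_le_left _ _)
  have hτm : τ ≤ m / 4 := le_trans (min_le_left _ _) (min_le_right _ _)
  have hτδ : 2 * τ * (3 * m + 1) / m ≤ δ := by
    have h1 : τ ≤ δ * m / (2 * (3 * m + 1)) := min_le_right _ _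
    rw [le_div_iff₀ (by positivity)] at h1
    rw [div_le_iff₀ hm0]
    linarith
  obtain ⟨U_R, hR⟩ := roughCard_calibration hf τ hτ0
  obtain ⟨U_A, hAU⟩ := hA τ hτ0
  refine ⟨max (max U_R U_A) (4 * ((univ.sup fun i => (f i).natDegree : ℕ) : ℝ) + 1),
    fun U hU => ?_⟩
  have hUR : U_R ≤ U := le_trans (le_trans (le_max_left _ _) (le_max_left _ _)) hU
  have hUA : U_A ≤ U := le_trans (le_trans (le_max_right _ _) (le_max_left _ _)) hU
  have hUc : 4 * ((univ.sup fun i => (f i).natDegree : ℕ) : ℝ) + 1 ≤ U :=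
    le_trans (le_max_right _ _) hU
  have hU0 : 0 < U := by
    linarith [Nat.cast_nonneg (α := ℝ) (univ.sup fun i => (f i).natDegree)]
  filter_upwards [primeCell_calibration hf hBH τ hτ0 U hUc, hR U hUR, hAU U hUA,
    eventually_ge_atTop 2] with x h1 h2 h4 hx2
  have hX : (0 : ℝ) < x := by exact_mod_cast (by omega : 0 < x)
  have hL0 : 0 < Real.log x ^ k := pow_pos (Real.log_pos (by exact_mod_cast hx2)) k
  have hAk : 0 < (U * Real.exp (-Real.eulerMascheroniConstant) / 2) ^ k := by positivity
  have hQ : (0 : ℝ) < 2 ^ k := by positivity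
  have hid : m * Real.exp (-((k : ℝ) * Real.eulerMascheroniConstant)) * U ^ k =
      m * ((2 : ℝ) ^ k * (U * Real.exp (-Real.eulerMascheroniConstant) / 2) ^ k) := by
    rw [two_pow_mul_shareBase_pow, mul_assoc]
  rw [hid] at h2
  have key := balance_arith hL0 hX hm0 hAk hQ hτ0.le hτ4 hτm h1 h2 h4
  exact key.trans (mul_le_mul_of_nonneg_right hτδ (Nat.cast_nonneg _))

end Exactness

/-! ### §6 Route-level corollaries: the split `BH = P ∧ A` is exact -/

open Summit.Parity.BatemanHorn.Theses.RoughParitySectors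

/-- **`BatemanHorn → RoughParityBalance → OddSectorShareNonlinear`**: the share crux (systems with a
member of degree `≥ 2`) follows from Bateman–Horn and the parity crux. [folklore] -/
theorem oddSectorShareNonlinear_of_batemanHorn_of_roughParityBalance
    (hBH : _root_.BatemanHorn) (hP : RoughParityBalance) : OddSectorShareNonlinear :=
  fun k f hf _ => Exactness.share_of_asymptotic_of_balance hf (hBH k f hf) (hP k f hf)

/-- **`BatemanHorn → RoughParityBalance → OddSectorShareLinear`**: the all-linear share crux follows
from Bateman–Horn and the parity crux (same proof; the degree profile is not used). [folklore] -/
theorem oddSectorShareLinear_of_batemanHorn_of_roughParityBalance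
    (hBH : _root_.BatemanHorn) (hP : RoughParityBalance) : OddSectorShareLinear :=
  fun k f hf _ => Exactness.share_of_asymptotic_of_balance hf (hBH k f hf) (hP k f hf)

/-- **`BatemanHorn → OddSectorShareNonlinear → OddSectorShareLinear → RoughParityBalance`**: the
parity crux follows from Bateman–Horn and the two share cruxes (case split on the degree profile).
[folklore] -/
theorem roughParityBalance_of_batemanHorn_of_shares (hBH : _root_.BatemanHorn)
    (hN : OddSectorShareNonlinear) (hL : OddSectorShareLinear) : RoughParityBalance := by
  intro k f hf
  by_cases h : ∃ i, 2 ≤ (f i).natDegree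
  · exact Exactness.balance_of_asymptotic_of_share hf (hBH k f hf) (hN k f hf h)
  · exact Exactness.balance_of_asymptotic_of_share hf (hBH k f hf)
      (hL k f hf fun i => by by_contra h'; exact h ⟨i, by omega⟩)

/-- **Modulo the parity crux, the share cruxes ARE Bateman–Horn**:
`RoughParityBalance → (OddSectorShareNonlinear ∧ OddSectorShareLinear ↔ BatemanHorn)`
(`→` is the route's `closes`, `←` is `share_of_asymptotic_of_balance`). [folklore] -/
theorem oddSectorShares_iff_batemanHorn (hP : RoughParityBalance) :
    (OddSectorShareNonlinear ∧ OddSectorShareLinear) ↔ _root_.BatemanHorn :=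
  ⟨fun h => closes hP h.1 h.2, fun h =>
    ⟨oddSectorShareNonlinear_of_batemanHorn_of_roughParityBalance h hP,
      oddSectorShareLinear_of_batemanHorn_of_roughParityBalance h hP⟩⟩

/-- **Modulo the share cruxes, the parity crux IS Bateman–Horn**:
`OddSectorShareNonlinear → OddSectorShareLinear → (RoughParityBalance ↔ BatemanHorn)`. [folklore] -/
theorem roughParityBalance_iff_batemanHorn (hN : OddSectorShareNonlinear)
    (hL : OddSectorShareLinear) : RoughParityBalance ↔ _root_.BatemanHorn :=
  ⟨fun hP => closes hP hN hL, fun h => roughParityBalance_of_batemanHorn_of_shares h hN hL⟩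

/-- **Minimality of the share side.**  Any statement `X` that closes Bateman–Horn together with the
parity crux already implies both share cruxes given the parity crux: modulo `RoughParityBalance`,
`OddSectorShareNonlinear ∧ OddSectorShareLinear` is the WEAKEST possible complement (no re-lining of the
share cruxes can ask for less and still close the route). [folklore] -/
theorem oddSectorShares_of_complement {X : Prop}
    (hX : RoughParityBalance → X → _root_.BatemanHorn) (hP : RoughParityBalance) (x : X) :
    OddSectorShareNonlinear ∧ OddSectorShareLinear :=
  (oddSectorShares_iff_batemanHorn hP).2 (hX hP x)

/-- **Minimality of the parity side.**  Any statement `X` that closes Bateman–Horn together with the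
two share cruxes already implies the parity crux given them: modulo the share cruxes,
`RoughParityBalance` is the weakest possible complement. [folklore] -/
theorem roughParityBalance_of_complement {X : Prop}
    (hX : X → OddSectorShareNonlinear → OddSectorShareLinear → _root_.BatemanHorn) (x : X)
    (hN : OddSectorShareNonlinear) (hL : OddSectorShareLinear) : RoughParityBalance :=
  (roughParityBalance_iff_batemanHorn hN hL).2 (hX x hN hL)

/-- **The route's `Assembly` item (stmt-Parity-15632) BY NAME**:
`RoughParityBalance → OddSectorShareNonlinear → OddSectorShareLinear → RoughCountBand → BatemanHorn` —
one line over the deciding theorem `closes` (the band hypothesis is not even needed: `closes` uses the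
landed band directly). [folklore] -/
theorem assembly_proof :
    RoughParityBalance → OddSectorShareNonlinear → OddSectorShareLinear → RoughCountBand →
      _root_.BatemanHorn :=
  fun hP hN hL _ => closes hP hN hL

/-- `assembly_proof` is the item `Assembly` by name (definitional unfolding). [folklore] -/
example : Assembly := assembly_proof

end Summit.Parity.BatemanHorn.Cruxes.OddSectorShareNonlinear.Birth
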